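import Summits.AnomalousDissipation.AnomalousDissipation.Theorems.SolenoidalFractalHomogenisationLagrangianStepVmodGenerator
import Summits.AnomalousDissipation.AnomalousDissipation.Theorems.SolenoidalFractalHomogenisationLagrangianStepVmodLinkForcing
import Summits.AnomalousDissipation.AnomalousDissipation.Theorems.SolenoidalFractalHomogenisationLagrangianStepVmodBridge
import Summits.AnomalousDissipation.AnomalousDissipation.Theorems.SolenoidalFractalHomogenisationLagrangianStepVmodCoarseDecay
import Summits.AnomalousDissipation.AnomalousDissipation.Theorems.SolenoidalFractalHomogenisationLagrangianStepPairData
import HarnessLib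

/-!
# K1L_D (stmt-AnomalousDissipation-27980): (V_mod) flat stage, block (ss) — THE GENERATOR REGIME AT THE PROPAGATOR LEVEL
# (cell units of `VmodFlat.SSMode_textE(H)`; rows «τ ≤ P» / «y < 1» of the certifier's table, tool T-G + L-sb)
(helper; `--supports 27980 --as helper`; prover ad-sawtooth-k1loc-p1 g15; assembles `…VmodGenerator` (weak-level T-G), `…VmodLinkForcing` (L-sb),
`…VmodBridge` (propagator ↔ mode representatives), `VmodFlat.norm_sq_fcoeff_carrierFree_decay` (coarse member) and lead-k1l-onelevel-p1's
`PropagatorSymm.eq_toLp_realTrigPoly_of_pair` (pair data are single real modes).)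

For the flat pair of the (V_mod) clause in cell units — `U` the propagator of the cell problem (carrier `cellField W M hM ν _ n`, tensor `(1/n²)•𝔸`,
`𝔸` in the ν-scaled nested window), `T` the carrier-free propagator with tensor `(1/n²)•(𝔸 + (c/ν)•Φ′)` (`Φ′` in the unscaled window, odd part `≤ β`)
— a window `[s,t] ⊆ [0,Tw]` whose start sees the carrier at phase 0 (`cellField … (s + τ) = cellField … τ`, e.g. `s ∈ (M·W.period/ν)·ℕ`,
`VmodGen.cellField_add_nat_mul_period`), a slow label `ℓ ≠ 0` with `2|ℓ| < n`, and a weakly divergence-free `v ∈ V2` supported on `{ℓ, −ℓ}`: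

  `‖𝓕((U−T)(s,t)v)(ℓ)‖ ≤ KG · (|ℓ|²/(n²ν)) · (t − s) · ‖𝓕v(ℓ)‖`,  `KG = 4π²·c·(hiΛ + β/2) + 32√2·Λ·(Σⱼ‖αⱼ‖)²/lo`   (`norm_fc_sub_le_generator`),

`αⱼ` the layer amplitudes of the word (`Sideband.slotAmp`, stretch-invariant: `slotAmp_stretch`).  Against the coarse loss weight
`dW = 1 − exp(−8π²·loT·|ℓ|²·(t−s))`, `loT = (ν + c/ν)(lo/Λ)/n² ≥ (c/ν)(lo/Λ)/n²`, the right side is `≤ (KG·Λ/(8π²·c·lo))·(8π²loT|ℓ|²(t−s))·‖𝓕v(ℓ)‖` —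
the generator regime of the single-pair target with a constant uniform in `ν, n, ℓ` (coarse AND high labels).
`sorry`-free; NOT a proof of (ss), of the stub, of K1L_D or of AD; rung F-D1.A0.
-/

set_option linter.dupNamespace false

noncomputable section

namespace Summit.AnomalousDissipation.AnomalousDissipation.Theorems.SolenoidalFractalHomogenisation.LagrangianStep.VmodGen

open Set MeasureTheory Complex UnitAddTorus
open scoped InnerProductSpace ENNReal
open Literature.Analysis Literature.Analysis.FunctionSpaces Literature.Analysis.FunctionSpaces.Torus
open Literature.Analysis.FluidPDE Literature.Analysis.FluidPDE.Torus Literature.Analysis.FluidPDE.LatticeShear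
open Summit.AnomalousDissipation.AnomalousDissipation.Theorems.SolenoidalFractalHomogenisation.LagrangianStep.CellChain (modeRep)
open Summit.AnomalousDissipation.AnomalousDissipation.Theorems.SolenoidalFractalHomogenisation.LagrangianStep.Sideband (slotAmp slotAmp_def)
open Summit.AnomalousDissipation.AnomalousDissipation.Theorems.SolenoidalFractalHomogenisation.LagrangianStep.VmodFlat
  (fc fc_sub norm_sq_fcoeff_carrierFree_decay)

variable {k₀ : ℕ}

/-! ## §1 Small tools -/

/-- The layer amplitudes do not see the slot durations: `slotAmp (W.stretch s) j = slotAmp W j`. [folklore] -/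
theorem slotAmp_stretch (W : LatticeWord k₀) (s : ℝ) (hs : 0 < s) (j : Fin k₀) : slotAmp (W.stretch s hs) j = slotAmp W j := rfl

/-- Parseval on a real pair: for `v ∈ V2` supported on `{ℓ, −ℓ}` (`ℓ ≠ 0`) and `F =ᵐ v`, `∫‖F‖² = 2‖𝓕v(ℓ)‖²`. [folklore] -/
theorem integral_norm_sq_eq_two_mul_of_pair {ℓ : Fin 3 → ℤ} (hℓ : ℓ ≠ 0) (v : V2)
    (hvs : ∀ k', k' ≠ ℓ → k' ≠ -ℓ → fc v k' = 0) {F : UnitAddTorus (Fin 3) → EuclideanSpace ℝ (Fin 3)} (hF2 : MemLp F 2 volume)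
    (hFv : (F : UnitAddTorus (Fin 3) → EuclideanSpace ℝ (Fin 3)) =ᵐ[volume] ⇑v) :
    ∫ x, ‖F x‖ ^ 2 = 2 * ‖fc v ℓ‖ ^ 2 := by
  classical
  have hne : ℓ ≠ -ℓ := fun h' => hℓ (by
    funext i; have hi := congrFun h' i; simp only [Pi.neg_apply] at hi; have : ℓ i = 0 := by omega
    simpa using this)
  have hcoef : ∀ k', mFourierCoeff (FunctionSpaces.EuclideanSpace.complexify ∘ F) k' = fc v k' := fun k' =>
    FunctionSpaces.Torus.mFourierCoeff_congr_ae (hFv.fun_comp FunctionSpaces.EuclideanSpace.complexify) k'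
  have hpars := hasSum_sq_norm_mFourierCoeff_complexify hF2
  have hfin : HasSum (fun k' => ‖mFourierCoeff (FunctionSpaces.EuclideanSpace.complexify ∘ F) k'‖ ^ 2)
      (∑ k' ∈ ({ℓ, -ℓ} : Finset (Fin 3 → ℤ)), ‖mFourierCoeff (FunctionSpaces.EuclideanSpace.complexify ∘ F) k'‖ ^ 2) := by
    refine hasSum_sum_of_ne_finset_zero fun k' hk' => ?_
    rw [Finset.mem_insert, Finset.mem_singleton, not_or] at hk'
    rw [hcoef, hvs k' hk'.1 hk'.2, norm_zero, zero_pow two_ne_zero]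
  rw [hpars.unique hfin, Finset.sum_pair hne, hcoef, hcoef]
  have hsymm := isConjSymm_mFourierCoeff (integrable_coe_V2 v) ℓ
  have e : fc v (-ℓ) = EuclideanSpace.conjVec (fc v ℓ) := hsymm
  rw [e, EuclideanSpace.norm_conjVec]
  ring

/-! ## §2 The generator regime at the propagator level -/

set_option maxHeartbeats 1600000 in
/-- **T-G AT THE PROPAGATOR LEVEL (cell units).**  See the module docstring: for the flat pair `(U, T)`, a window start at carrier phase 0, a slow
label `ℓ ≠ 0` with `2|ℓ| < n` and a weakly divergence-free pair datum `v`,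
`‖𝓕((U−T)(s,t)v)(ℓ)‖ ≤ (4π²c(hiΛ + β/2) + 32√2·Λ(Σⱼ‖αⱼ‖)²/lo)·(|ℓ|²/(n²ν))·(t−s)·‖𝓕v(ℓ)‖`.
[cite: Hale1980, Ch. III §1, Theorem 1.1] [cite: BedrossianCotiZelati2017, §2] [cite: MeshalkinSinai1961, pp. 1700–1705] -/
theorem norm_fc_sub_le_generator (W : LatticeWord k₀) (M : ℝ) (hM : 0 < M) {c : ℝ} (hc : 0 ≤ c)
    {lo hi Λ β : ℝ} (hlo : 0 < lo) (hhi : 0 ≤ hi) (hΛ : 1 ≤ Λ) (hβ : 0 ≤ β)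
    {ν : ℝ} (hν : 0 < ν) {n : ℕ} (hn : 1 ≤ n) {𝔸 Φ' : Visc4 (Fin 3)}
    (hwin : ∃ lam ∈ Set.Icc (1:ℝ) Λ, NearIso 𝔸 (ν * (lo / lam)) (ν * (hi * lam)))
    (hΦo : OddSmall Φ' β) (hΦw : ∃ lam ∈ Set.Icc (1:ℝ) Λ, NearIso Φ' (lo / lam) (hi * lam))
    {Tw : ℝ} {U T : ℝ → ℝ → (V2 →L[ℝ] V2)}
    (hU : IsPropagator Tw (cellField W M hM ν hν n) ((1 / (n:ℝ) ^ 2) • 𝔸) U)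
    (hT : IsPropagator Tw (fun (_ : ℝ) (_ : UnitAddTorus (Fin 3)) => (0 : EuclideanSpace ℝ (Fin 3))) ((1 / (n:ℝ) ^ 2) • (𝔸 + (c / ν) • Φ')) T)
    {s t : ℝ} (hs : 0 ≤ s) (hst : s ≤ t) (htT : t ≤ Tw) (hsT : s < Tw)
    (hphase : ∀ τ, cellField W M hM ν hν n (s + τ) = cellField W M hM ν hν n τ)
    {ℓ : Fin 3 → ℤ} (hℓ0 : ℓ ≠ 0) (hℓn : 2 * Real.sqrt (freqNormSq ℓ) < n)
    (v : V2) (hv : v ∈ divFreeL2 (Fin 3)) (hvs : ∀ k', k' ≠ ℓ → k' ≠ -ℓ → fc v k' = 0) :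
    ‖fc (U s t v - T s t v) ℓ‖ ≤
      (4 * Real.pi ^ 2 * c * (hi * Λ + β / 2) + 32 * Real.sqrt 2 * Λ * (∑ j, ‖slotAmp W j‖) ^ 2 / lo)
        * (freqNormSq ℓ / ((n:ℝ) ^ 2 * ν)) * (t - s) * ‖fc v ℓ‖ := by
  classical
  -- positivity bookkeeping
  have hnpos : 0 < n := hn
  have hn0 : (0:ℝ) < n := by exact_mod_cast hnpos
  have hn1 : n ≠ 0 := Nat.pos_iff_ne_zero.1 hnpos
  have hn2 : (0:ℝ) < 1 / (n:ℝ) ^ 2 := by positivity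
  have hΛ0 : 0 < Λ := lt_of_lt_of_le one_pos hΛ
  have hcν : 0 ≤ c / ν := div_nonneg hc hν.le
  have hL0 : 0 < Tw - s := by linarith
  -- the stretched word whose cell field is the carrier
  set W₁ : LatticeWord k₀ := (W.stretch M hM).stretch (1 / ν) (one_div_pos.mpr hν) with hW₁
  -- windows: lam-free for the cell tensor, explicit for the coarse tensor
  have hAΛ : NearIso 𝔸 (ν * (lo / Λ)) (ν * (hi * Λ)) := by
    obtain ⟨lam, hlam, hA⟩ := hwin
    have hlam1 : 0 < lam := lt_of_lt_of_le one_pos hlam.1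
    exact hA.mono (mul_le_mul_of_nonneg_left (div_le_div_of_nonneg_left hlo.le hlam1 hlam.2) hν.le)
      (mul_le_mul_of_nonneg_left (mul_le_mul_of_nonneg_left hlam.2 hhi) hν.le)
  have hN : NearIso ((1 / (n:ℝ) ^ 2) • 𝔸) ((1 / (n:ℝ) ^ 2) * (ν * (lo / Λ))) ((1 / (n:ℝ) ^ 2) * (ν * (hi * Λ))) :=
    hAΛ.smul hn2.le
  have hloU : 0 < (1 / (n:ℝ) ^ 2) * (ν * (lo / Λ)) := by positivity
  have hloA : 0 < ν * (lo / Λ) := by positivity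
  obtain ⟨lam', hlam', hΦn⟩ := hΦw
  have hlam'0 : 0 < lam' := lt_of_lt_of_le one_pos hlam'.1
  set 𝔻 : Visc4 (Fin 3) := (1 / (n:ℝ) ^ 2) • ((c / ν) • Φ') with h𝔻
  have h𝔻win : NearIso 𝔻 ((1 / (n:ℝ) ^ 2) * ((c / ν) * (lo / lam'))) ((1 / (n:ℝ) ^ 2) * ((c / ν) * (hi * lam'))) :=
    (hΦn.smul hcν).smul hn2.le
  have h𝔻win' : NearIso 𝔻 0 ((1 / (n:ℝ) ^ 2) * ((c / ν) * (hi * Λ))) :=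
    h𝔻win.mono (by positivity) (mul_le_mul_of_nonneg_left (mul_le_mul_of_nonneg_left (mul_le_mul_of_nonneg_left hlam'.2 hhi) hcν) hn2.le)
  have h𝔻odd : OddSmall 𝔻 ((1 / (n:ℝ) ^ 2) * ((c / ν) * β)) := (hΦo.smul (c / ν)).smul (1 / (n:ℝ) ^ 2)
  have hsplit : (1 / (n:ℝ) ^ 2) • (𝔸 + (c / ν) • Φ') = (1 / (n:ℝ) ^ 2) • 𝔸 + 𝔻 := by rw [h𝔻, smul_add]
  have hcoarse : NearIso ((1 / (n:ℝ) ^ 2) • (𝔸 + (c / ν) • Φ'))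
      ((1 / (n:ℝ) ^ 2) * (ν * (lo / Λ)) + (1 / (n:ℝ) ^ 2) * ((c / ν) * (lo / lam')))
      ((1 / (n:ℝ) ^ 2) * (ν * (hi * Λ)) + (1 / (n:ℝ) ^ 2) * ((c / ν) * (hi * lam'))) := by
    rw [hsplit]; exact hN.add h𝔻win
  have hloT : 0 < (1 / (n:ℝ) ^ 2) * (ν * (lo / Λ)) + (1 / (n:ℝ) ^ 2) * ((c / ν) * (lo / lam')) := by positivity
  -- the datum as a real single mode `F`
  have hvs' : ∀ k', k' ≠ ℓ → k' ≠ -ℓ → mFourierCoeff (FunctionSpaces.EuclideanSpace.complexify ∘ ⇑v) k' = 0 := hvs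
  set F : UnitAddTorus (Fin 3) → EuclideanSpace ℝ (Fin 3) :=
    FunctionSpaces.Torus.realTrigPoly {ℓ} (fun _ => (2:ℂ) • mFourierCoeff (FunctionSpaces.EuclideanSpace.complexify ∘ ⇑v) ℓ) with hF
  have hF2 : MemLp F 2 volume := FunctionSpaces.Torus.memLp_realTrigPoly {ℓ} _ 2
  have hFi : Integrable F volume := hF2.integrable one_le_two
  have hvF : v = hF2.toLp F := PropagatorSymm.eq_toLp_realTrigPoly_of_pair hℓ0 v hvs'
  have hFv : (F : UnitAddTorus (Fin 3) → EuclideanSpace ℝ (Fin 3)) =ᵐ[volume] ⇑v := by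
    rw [hvF]; exact (MemLp.coeFn_toLp hF2).symm
  have hFdiv : FunctionSpaces.Torus.IsWeaklyDivFree F := ((mem_divFreeL2_iff v).1 hv).congr_ae hFv.symm
  have hcoef : ∀ k', mFourierCoeff (FunctionSpaces.EuclideanSpace.complexify ∘ F) k' = fc v k' := fun k' =>
    FunctionSpaces.Torus.mFourierCoeff_congr_ae (hFv.fun_comp FunctionSpaces.EuclideanSpace.complexify) k'
  have hsuppF : ∀ k', k' ≠ ℓ → k' ≠ -ℓ → mFourierCoeff (FunctionSpaces.EuclideanSpace.complexify ∘ F) k' = 0 := fun k' h1 h2 => by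
    rw [hcoef]; exact hvs k' h1 h2
  -- the two bridges at the window start `s`
  have hU' : IsPropagator Tw (W₁.cell n) ((1 / (n:ℝ) ^ 2) • 𝔸) U := hU
  have hphase' : ∀ τ, W₁.cell n (s + τ) = W₁.cell n τ := hphase
  obtain ⟨u, hu, hUeq⟩ := exists_sol_forall_fcoeff_eq_modeRep W₁ n hN hloU hU' hs hsT hphase' hF2 hFdiv
  obtain ⟨w, hw, hTeq⟩ := exists_sol_forall_fcoeff_eq_modeRep_free W₁ hcoarse hloT hT hs hsT hF2 hFdiv
  -- (D) the projected symbol difference on transversal vectors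
  set D : ℝ := ((1 / (n:ℝ) ^ 2) * ((c / ν) * (hi * Λ)) + (1 / (n:ℝ) ^ 2) * ((c / ν) * β) / 2) * freqNormSq ℓ with hD
  have hD0 : 0 ≤ D := by rw [hD]; have := freqNormSq_nonneg ℓ; positivity
  have hDb : ∀ y : EuclideanSpace ℂ (Fin 3), kdot ℓ y = 0 →
      ‖transversalProj ℓ (symbT (majorTranspose ((1 / (n:ℝ) ^ 2) • 𝔸)) ℓ y) -
        transversalProj ℓ (symbT (majorTranspose ((1 / (n:ℝ) ^ 2) • (𝔸 + (c / ν) • Φ'))) ℓ y)‖ ≤ D * ‖y‖ := by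
    intro y hy
    rw [hsplit, majorTranspose_add, symbT_add_tensor, map_add, sub_add_cancel_left, norm_neg, hD]
    exact norm_transversalProj_symbT_le h𝔻win' le_rfl (by positivity) h𝔻odd (by positivity) ℓ hy
  -- (X) the coarse slow mode never exceeds the datum's coefficient
  have hX : ∀ σ ∈ Icc 0 (Tw - s), ‖modeRep W₁ 0 ((1 / (n:ℝ) ^ 2) • (𝔸 + (c / ν) • Φ')) F w ℓ σ‖ ≤ ‖fc v ℓ‖ := by
    intro σ hσ
    rw [← hTeq σ hσ ℓ, ← hvF]
    have hsσ : s ≤ s + σ := by linarith [hσ.1]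
    have hσT : s + σ ≤ Tw := by linarith [hσ.2]
    have h1 := norm_sq_fcoeff_carrierFree_decay hcoarse hloT hT hs hsσ hσT hsT v ((mem_divFreeL2_iff v).1 hv) ℓ
    have h2 : ‖fc (T s (s + σ) v) ℓ‖ ^ 2 ≤ ‖fc v ℓ‖ ^ 2 := h1.trans (mul_le_of_le_one_left (sq_nonneg _) (Real.exp_le_one_iff.2 (by
      have := freqNormSq_nonneg ℓ; have : 0 ≤ σ := hσ.1
      have : 0 ≤ 8 * Real.pi ^ 2 * ((1 / (n:ℝ) ^ 2) * (ν * (lo / Λ)) + (1 / (n:ℝ) ^ 2) * ((c / ν) * (lo / lam'))) * freqNormSq ℓ * (s + σ - s) := by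
        have : 0 ≤ s + σ - s := by linarith
        positivity
      linarith)))
    exact (pow_le_pow_iff_left₀ (norm_nonneg _) (norm_nonneg _) two_ne_zero).1 h2
  -- (Lf) the link forcing of the pair datum (sideband slaving)
  have hLf := fun σ (hσ : σ ∈ Icc 0 (Tw - s)) => norm_linkForcing_le W₁ hn1 hL0 hAΛ hloA hℓ0 hℓn hF2 hFdiv hsuppF hu hσ
  -- the weak-level comparison on `[0, Tw − s]`, read at `τ = t − s`
  have hτ : t - s ∈ Icc 0 (Tw - s) := ⟨by linarith, by linarith⟩
  have key := norm_modeRep_sub_le W₁ n hL0.le hN hloU.le hFi hu hw hℓ0 hD0 hDb hX hLf (t - s) hτ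
  -- back to the propagators
  have est : s + (t - s) = t := by ring
  have e1 : fc (U s t v) ℓ = modeRep W₁ n ((1 / (n:ℝ) ^ 2) • 𝔸) F u ℓ (t - s) := by
    have h := hUeq (t - s) hτ ℓ
    rw [est] at h
    rw [hvF]; exact h
  have e2 : fc (T s t v) ℓ = modeRep W₁ 0 ((1 / (n:ℝ) ^ 2) • (𝔸 + (c / ν) • Φ')) F w ℓ (t - s) := by
    have h := hTeq (t - s) hτ ℓ
    rw [est] at h
    rw [hvF]; exact h
  rw [fc_sub, e1, e2]
  refine key.trans (le_of_eq ?_)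
  -- bookkeeping of the constant
  have hint : ∫ x, ‖F x‖ ^ 2 = 2 * ‖fc v ℓ‖ ^ 2 := integral_norm_sq_eq_two_mul_of_pair hℓ0 v hvs hF2 hFv
  have hsqrtF : Real.sqrt (∫ x, ‖F x‖ ^ 2) = Real.sqrt 2 * ‖fc v ℓ‖ := by
    rw [hint, Real.sqrt_mul (by norm_num), Real.sqrt_sq (norm_nonneg _)]
  have hα : (∑ j, ‖slotAmp W₁ j‖) = ∑ j, ‖slotAmp W j‖ := Finset.sum_congr rfl fun j _ => rfl
  have hsq : Real.sqrt (freqNormSq ℓ) ^ 2 = freqNormSq ℓ := Real.sq_sqrt (freqNormSq_nonneg ℓ)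
  have hνne : ν ≠ 0 := hν.ne'
  have hnne : (n:ℝ) ≠ 0 := hn0.ne'
  have hlone : lo ≠ 0 := hlo.ne'
  have hΛne : Λ ≠ 0 := hΛ0.ne'
  rw [div_pow, hsq, hα, hsqrtF, hD]
  field_simp

end Summit.AnomalousDissipation.AnomalousDissipation.Theorems.SolenoidalFractalHomogenisation.LagrangianStep.VmodGen

end
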